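import Summits.CriticalPhenomena.PercolationContinuityZ3.Theorems.PercNearOneGluingNoHeavyLowerTailSahiCombTriWCone
import Summits.CriticalPhenomena.PercolationContinuityZ3.Theorems.PercNearOneGluingNoHeavyLowerTailSahiCombTriWDisjointGens

/-!
# `TriWIneq` for AND–OR–AND read-once families: `x_g ∧ (x_{h₁} ∨ ⋯ ∨ x_{h_k})` with `g, h₁, …, h_k` pairwise disjoint, all `n`, all `a`

Support file of the one-cut programme (crux `NoHeavyLowerTail`, stmt-CriticalPhenomena-4575; unit `prim-lf-1` gen 41, memo
`FROM-prim-lf-1-gen41-SHELLS-AND-OR-PRODUCTS.md` §5).  Combination of the CONE THEOREM (`…SahiCombTriWCone`: a cone over a Kleitman-shell family satisfies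
`TriWIneq`) with the disjoint-generator shells (`…SahiCombTriWDisjointGens`: `klShell_genUp_disjoint`): the family
`coneGen g gens = {t | g ⊆ t ∧ ∃ h ∈ gens, h ⊆ t}` — the monotone read-once formula `(⋀_{i∈g} x_i) ∧ ⋁_{h ∈ gens} (⋀_{j∈h} x_j)` on pairwise disjoint variable
blocks, free coordinates allowed — satisfies `TriWIneq` for every apex `g` and every set `gens` of pairwise disjoint nonempty generators disjoint from `g`.
Special cases: stars (`gens` = singletons of `h`, `…TriWStars`), `x_g(x₁ ∨ x₂x₃)`, `x_g(x₁x₂ ∨ x₃x₄)`, principal (`gens = {∅}` is excluded; `gens = {h}` gives `↑(g ∪ h)`).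

* `FiveUpSet.coneGen`, `isUpperSet_coneGen`;  `FiveUpSet.famMap_coneGen` — `famMap (blockEquiv g) (coneGen g gens) = andTop (genUp (gens.image (inCoblock g)))`;
* **`FiveUpSet.triW_nonneg_coneGen`** — `0 ≤ triW (coneGen g gens) F G` for every index cube and all monotone families of up-sets.
HONEST LABEL: complete proofs, std axioms; a new unconditional stratum; `TriWIneq` itself stays OPEN. [this work]
-/

namespace Summit.CriticalPhenomena.PercolationContinuityZ3.Theorems

namespace FiveUpSet

open Finset

variable {β γ : Type} [DecidableEq β] [Fintype β] [DecidableEq γ] [Fintype γ]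

/-- The AND–OR–AND family `x_g ∧ ⋁_{h∈gens} x_h = {t | g ⊆ t ∧ ∃ h ∈ gens, h ⊆ t}`. [this work] -/
def coneGen (g : Finset γ) (gens : Finset (Finset γ)) : Finset (Finset γ) := univ.filter fun t => g ⊆ t ∧ ∃ h ∈ gens, h ⊆ t

omit [DecidableEq β] [Fintype β] in
/-- Membership in `coneGen`. [this work] -/
@[simp] theorem mem_coneGen {g : Finset γ} {gens : Finset (Finset γ)} {t : Finset γ} :
    t ∈ coneGen g gens ↔ g ⊆ t ∧ ∃ h ∈ gens, h ⊆ t := by simp [coneGen]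

omit [DecidableEq β] [Fintype β] in
/-- `coneGen` is an up-set. [this work] -/
theorem isUpperSet_coneGen (g : Finset γ) (gens : Finset (Finset γ)) : IsUpperSet (coneGen g gens : Set (Finset γ)) := by
  intro t t' htt' ht
  rw [mem_coe, mem_coneGen] at ht ⊢
  obtain ⟨hg, h, hh, hht⟩ := ht
  exact ⟨hg.trans htt', h, hh, hht.trans htt'⟩

omit [DecidableEq β] [Fintype β] in
/-- **The relabeled AND–OR–AND family is the cone over the disjoint-generator family of the complement block.** [this work] -/
theorem famMap_coneGen {g : Finset γ} {gens : Finset (Finset γ)} (hrest : ∀ h ∈ gens, Disjoint g h) :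
    famMap (blockEquiv g) (coneGen g gens) = andTop (genUp (gens.image (inCoblock g))) := by
  ext s
  rw [mem_famMap, mem_coneGen, mem_andTop, mem_genUp]
  simp only [mem_image]
  have hL : g ⊆ s.map (blockEquiv g).symm.toEmbedding ↔ s.toLeft = univ := by
    constructor
    · intro hsub
      exact eq_univ_of_forall fun x => mem_toLeft.2 ((inl_mem_iff x).1 (hsub x.2))
    · intro hsub a ha
      have := hsub ▸ mem_univ (⟨a, ha⟩ : {a // a ∈ g})
      rw [mem_toLeft] at this
      exact (inl_mem_iff ⟨a, ha⟩).2 this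
  have hR : ∀ h ∈ gens, (h ⊆ s.map (blockEquiv g).symm.toEmbedding ↔ inCoblock g h ⊆ s.toRight) := by
    intro h hh
    constructor
    · intro hsub y hy
      simp only [inCoblock, mem_filter, mem_univ, true_and] at hy
      rw [mem_toRight]
      exact (inr_mem_iff y).1 (hsub hy)
    · intro hsub a ha
      have hag : a ∉ g := fun hag => disjoint_left.1 (hrest h hh) hag ha
      have := hsub (show (⟨a, hag⟩ : {a // a ∉ g}) ∈ inCoblock g h by simp [inCoblock, ha])
      rw [mem_toRight] at this
      exact (inr_mem_iff ⟨a, hag⟩).2 this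
  rw [hL]
  constructor
  · rintro ⟨h1, h, hh, hsub⟩
    exact ⟨h1, inCoblock g h, ⟨h, hh, rfl⟩, (hR h hh).1 hsub⟩
  · rintro ⟨h1, _, ⟨h, hh, rfl⟩, hsub⟩
    exact ⟨h1, h, hh, (hR h hh).2 hsub⟩

/-- **`TriWIneq` for `x_g ∧ (x_{h₁} ∨ ⋯ ∨ x_{h_k})`**: if the generators in `gens` are nonempty, pairwise disjoint and disjoint from `g`, then
`0 ≤ triW (coneGen g gens) F G` for EVERY index cube `Finset β` and all monotone families `F, G` of up-sets of `Finset γ`. [this work] -/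
theorem triW_nonneg_coneGen {g : Finset γ} {gens : Finset (Finset γ)} (hrest : ∀ h ∈ gens, Disjoint g h)
    (hne : ∀ h ∈ gens, h.Nonempty) (hdis : ∀ h₁ ∈ gens, ∀ h₂ ∈ gens, h₁ ≠ h₂ → Disjoint h₁ h₂)
    (F G : Finset β → Finset (Finset γ))
    (hF : ∀ x, IsUpperSet (F x : Set (Finset γ))) (hG : ∀ x, IsUpperSet (G x : Set (Finset γ)))
    (hFm : Monotone F) (hGm : Monotone G) :
    0 ≤ triW (coneGen g gens) F G := by
  -- the generators of the complement block are nonempty and pairwise disjoint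
  have hne' : ∀ h' ∈ gens.image (inCoblock g), h'.Nonempty := by
    intro h' hh'
    rw [mem_image] at hh'
    obtain ⟨h, hh, rfl⟩ := hh'
    obtain ⟨a, ha⟩ := hne h hh
    have hag : a ∉ g := fun hag => disjoint_left.1 (hrest h hh) hag ha
    exact ⟨⟨a, hag⟩, by simp [inCoblock, ha]⟩
  have hdis' : ∀ h₁ ∈ gens.image (inCoblock g), ∀ h₂ ∈ gens.image (inCoblock g), h₁ ≠ h₂ → Disjoint h₁ h₂ := by
    intro h₁ h₁m h₂ h₂m hne12
    rw [mem_image] at h₁m h₂m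
    obtain ⟨a₁, ha₁, rfl⟩ := h₁m
    obtain ⟨a₂, ha₂, rfl⟩ := h₂m
    have hne'' : a₁ ≠ a₂ := fun h => hne12 (h ▸ rfl)
    have hd := hdis a₁ ha₁ a₂ ha₂ hne''
    rw [disjoint_left] at hd ⊢
    intro y hy₁ hy₂
    simp only [inCoblock, mem_filter, mem_univ, true_and] at hy₁ hy₂
    exact hd hy₁ hy₂
  refine triW_nonneg_of_famMap (blockEquiv g) (fun F' G' hF' hG' hF'm hG'm => ?_) F G hF hG hFm hGm
  rw [famMap_coneGen hrest]
  exact triW_nonneg_andTop (isUpperSet_genUp _) (klShell_genUp_disjoint hne' hdis') F' G' hF' hG' hF'm hG'm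

end FiveUpSet

end Summit.CriticalPhenomena.PercolationContinuityZ3.Theorems
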